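import Mathlib
import Summits.Ventures.DiscreteObjects.Mahler.TraceLiftMeasure
import Literature.NumberTheory.MahlerMeasure.MinimalMeasuresByDegree

/-!
# Kernel certificate of the degree-18 minimal measure (MRW Table 1, `D = 18`) (venture `DiscreteObjects`, target L)

Cell `pub-namedobj`, seat `pub-namedobj-mahler` (gen 10). Framing: lottery ticket; floor = certified
bounds/negative ranges.

PRINT CONTROL in the kernel via the generic Salem certificate `salem_traceLift_certificate`: the
Mossinghoff–Rhin–Wu Table-1 minimiser of degree 18 (`Literature.NumberTheory.MahlerMeasure.mrwPoly18`, printed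
measure `1.18836815`, `ν = 1` [cite: MossinghoffRhinWu2008, Table 1 p.453]) is the reciprocal lift of the
degree-9 trace polynomial `Q` below, whose 9 real roots are located by sign changes (8 of them in `(-2, 2)`,
one just below `-2`); hence it is a Salem polynomial and `M + M⁻¹ = |y₁|` gives
`1.18836814 < M(mrwPoly18) < 1.18836815`.
-/

namespace Summit.Ventures.DiscreteObjects.Mahler

open Polynomial Literature.NumberTheory.MahlerMeasure

/-- The trace polynomial of the degree-18 minimiser. -/
theorem traceLift_mrwTrace18 : traceLift (X ^ 9 + X ^ 8 - C 8 * X ^ 7 - C 7 * X ^ 6 + C 20 * X ^ 5 + C 14 * X ^ 4 - C 17 * X ^ 3 - C 8 * X ^ 2 + C 4 * X + 1 : ℤ[X]) = mrwPoly18 := by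
  have hdeg : (X ^ 9 + X ^ 8 - C 8 * X ^ 7 - C 7 * X ^ 6 + C 20 * X ^ 5 + C 14 * X ^ 4 - C 17 * X ^ 3 - C 8 * X ^ 2 + C 4 * X + 1 : ℤ[X]).natDegree = 9 := by compute_degree!
  rw [traceLift, hdeg, mrwPoly18]
  simp only [Finset.sum_range_succ, Finset.sum_range_zero, zero_add, coeff_add, coeff_sub, coeff_X_pow,
    coeff_C_mul, coeff_X, coeff_one]
  norm_num
  ring

/-- **`1.18836814 < M(mrwPoly18) < 1.18836815`** (MRW Table 1, `D = 18`: `1.18836815`, `ν = 1`). -/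
theorem mrwPoly18_measure_enclosure :
    (118836814 / 10 ^ 8 : ℝ) < intMahlerMeasure mrwPoly18 ∧ intMahlerMeasure mrwPoly18 < 118836815 / 10 ^ 8 := by
  set Q : ℤ[X] := X ^ 9 + X ^ 8 - C 8 * X ^ 7 - C 7 * X ^ 6 + C 20 * X ^ 5 + C 14 * X ^ 4 - C 17 * X ^ 3 - C 8 * X ^ 2 + C 4 * X + 1 with hQdef
  have hQmonic : Q.Monic := by rw [hQdef]; monicity!
  have hQdeg : Q.natDegree = 9 := by rw [hQdef]; compute_degree!
  set f : ℝ → ℝ := fun y => y ^ 9 + y ^ 8 - 8 * y ^ 7 - 7 * y ^ 6 + 20 * y ^ 5 + 14 * y ^ 4 - 17 * y ^ 3 - 8 * y ^ 2 + 4 * y + 1 with hf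
  have hcont : Continuous f := by rw [hf]; fun_prop
  have hfQ : ∀ y : ℝ, aeval (y : ℂ) Q = ((f y : ℝ) : ℂ) := by
    intro y
    rw [hQdef, hf]
    simp only [map_add, map_sub, map_mul, map_pow, aeval_X, map_ofNat, map_one]
    push_cast; ring
  have root : ∀ a b : ℝ, a ≤ b → (f a < 0 ∧ 0 < f b) ∨ (f b < 0 ∧ 0 < f a) →
      ∃ y, a < y ∧ y < b ∧ f y = 0 := by
    intro a b hab h
    rcases h with ⟨ha, hb⟩ | ⟨hb, ha⟩
    · obtain ⟨y, hy, hfy⟩ := intermediate_value_Ioo hab hcont.continuousOn ⟨ha, hb⟩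
      exact ⟨y, hy.1, hy.2, hfy⟩
    · obtain ⟨y, hy, hfy⟩ := intermediate_value_Ioo' hab hcont.continuousOn ⟨hb, ha⟩
      exact ⟨y, hy.1, hy.2, hfy⟩
  set c₁ : ℝ := 118836814 / 10 ^ 8 with hc₁
  set c₂ : ℝ := 118836815 / 10 ^ 8 with hc₂
  obtain ⟨y1, h1a, h1b, h1f⟩ := root (-(c₂ + c₂⁻¹)) (-(c₁ + c₁⁻¹)) (by rw [hc₁, hc₂]; norm_num)
    (Or.inl ⟨by rw [hf, hc₂]; norm_num, by rw [hf, hc₁]; norm_num⟩)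
  obtain ⟨y2, h2a, h2b, h2f⟩ := root ((-2) : ℝ) (((-3) : ℝ) / 2) (by norm_num)
    (Or.inr ⟨by rw [hf]; norm_num, by rw [hf]; norm_num⟩)
  obtain ⟨y3, h3a, h3b, h3f⟩ := root (((-3) : ℝ) / 2) ((-1) : ℝ) (by norm_num)
    (Or.inl ⟨by rw [hf]; norm_num, by rw [hf]; norm_num⟩)
  obtain ⟨y4, h4a, h4b, h4f⟩ := root ((-1) : ℝ) (((-1) : ℝ) / 2) (by norm_num)
    (Or.inr ⟨by rw [hf]; norm_num, by rw [hf]; norm_num⟩)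
  obtain ⟨y5, h5a, h5b, h5f⟩ := root (((-1) : ℝ) / 2) (0 : ℝ) (by norm_num)
    (Or.inl ⟨by rw [hf]; norm_num, by rw [hf]; norm_num⟩)
  obtain ⟨y6, h6a, h6b, h6f⟩ := root (0 : ℝ) ((3 : ℝ) / 4) (by norm_num)
    (Or.inr ⟨by rw [hf]; norm_num, by rw [hf]; norm_num⟩)
  obtain ⟨y7, h7a, h7b, h7f⟩ := root ((3 : ℝ) / 4) (1 : ℝ) (by norm_num)
    (Or.inl ⟨by rw [hf]; norm_num, by rw [hf]; norm_num⟩)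
  obtain ⟨y8, h8a, h8b, h8f⟩ := root (1 : ℝ) ((7 : ℝ) / 4) (by norm_num)
    (Or.inr ⟨by rw [hf]; norm_num, by rw [hf]; norm_num⟩)
  obtain ⟨y9, h9a, h9b, h9f⟩ := root ((7 : ℝ) / 4) (2 : ℝ) (by norm_num)
    (Or.inl ⟨by rw [hf]; norm_num, by rw [hf]; norm_num⟩)
  have hc1y : -(c₁ + c₁⁻¹) < -2 := by rw [hc₁]; norm_num
  have hy1 : y1 < -2 := lt_trans h1b hc1y
  set l : List ℝ := [y1, y2, y3, y4, y5, y6, y7, y8, y9] with hl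
  set s : Multiset ℝ := (l : Multiset ℝ) with hs
  -- the roots are listed in increasing order, hence distinct
  have hchain : List.IsChain (· < ·) l := by
    rw [hl]
    simp only [List.isChain_cons_cons, List.isChain_singleton, and_true]
    refine ⟨by linarith, by linarith, by linarith, by linarith, by linarith, by linarith, by linarith, by linarith⟩
  have hnodup : s.Nodup := by
    rw [hs, Multiset.coe_nodup]
    exact (List.isChain_iff_pairwise.mp hchain).imp (fun h => ne_of_lt h)
  have hcard : Multiset.card s = Q.natDegree := by rw [hQdeg, hs, Multiset.coe_card, hl]; rfl
  have hroot : ∀ y ∈ s, aeval (y : ℂ) Q = 0 := by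
    intro y hy
    rw [hs, Multiset.mem_coe, hl] at hy
    simp only [List.mem_cons, List.mem_nil_iff, or_false] at hy
    rw [hfQ]
    rcases hy with h | h | h | h | h | h | h | h | h
    · rw [h, h1f]; simp
    · rw [h, h2f]; simp
    · rw [h, h3f]; simp
    · rw [h, h4f]; simp
    · rw [h, h5f]; simp
    · rw [h, h6f]; simp
    · rw [h, h7f]; simp
    · rw [h, h8f]; simp
    · rw [h, h9f]; simp
  have hy₁ : y1 ∈ s := by rw [hs, Multiset.mem_coe, hl]; simp
  have hbig : 2 < |y1| := by rw [abs_of_neg (by linarith)]; linarith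
  have hsmall : ∀ y ∈ s.erase y1, |y| ≤ 2 := by
    intro y hy
    rw [hs, Multiset.coe_erase, hl, List.erase_cons_head, Multiset.mem_coe] at hy
    simp only [List.mem_cons, List.mem_nil_iff, or_false] at hy
    rw [abs_le]
    rcases hy with h | h | h | h | h | h | h | h <;> (rw [h]; constructor <;> linarith)
  obtain ⟨-, hM1, hMM⟩ := salem_traceLift_certificate hQmonic s hnodup hcard hroot hy₁ hbig hsmall
  rw [traceLift_mrwTrace18] at hM1 hMM
  rw [abs_of_neg (by linarith)] at hMM
  have hMpos : 0 < intMahlerMeasure mrwPoly18 := by linarith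
  constructor
  · have h : c₁ + c₁⁻¹ < intMahlerMeasure mrwPoly18 + (intMahlerMeasure mrwPoly18)⁻¹ := by
      rw [hMM]; linarith
    exact lt_of_add_inv_lt_add_inv hM1.le (by rw [hc₁]; norm_num) h
  · have h : intMahlerMeasure mrwPoly18 + (intMahlerMeasure mrwPoly18)⁻¹ < c₂ + c₂⁻¹ := by
      rw [hMM]; linarith
    exact lt_of_add_inv_lt_add_inv (by rw [hc₂]; norm_num) hMpos h

end Summit.Ventures.DiscreteObjects.Mahler
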